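import Literature.Analysis.Complex.OpensFlat
import Literature.Analysis.Calculus.ConePoincareHomotopyBanach
import HarnessLib

/-!
# The Poincaré lemma on convex open subsets of a Banach space (discharge of `ExactSmoothFormsEqClosedSmoothFormsOfConvex`)

Topic `NumberTheory/Transcendental` (trunk TranscendKaehlerL, item C6 `FormsAlgebra`).  Theorems only;
no definition, no named fact, no `sorry` (D-0026: one named fact DISCHARGED, none introduced).

`Literature.NumberTheory.Transcendental.ExactSmoothFormsEqClosedSmoothFormsOfConvex E F`
(`FormsAlgebra.lean`) is the named fact (D-0014): for every convex open subset `U` of a complete real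
normed space `E` — a manifold via `𝓘(ℝ, E)`, with Mathlib's open-submanifold structure on `↥U` — and
every `k`, the exact smooth `(k+1)`-forms on `U` with values in a complete space `F` are exactly the
closed ones, `B^{k+1}(U) = Z^{k+1}(U)` (Warner (1983), 4.18; Bott–Tu (1982), Cor. 4.1.1; for `E`
Banach: Lang (1995), Ch. V §4, Thm. 4.1).  This file proves it:

* `exactSmoothForms_le_closedSmoothForms_opens` — `B ⊆ Z` on `↥U` (`d ∘ d = 0`, the tree's
  `exactSmoothForms_le_closedSmoothForms` fed with the discharged chart-independence fact
  `inChart_mextDeriv_holds`);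
* `mem_exactSmoothForms_of_mem_closedSmoothForms_of_convex` — `Z ⊆ B`: a closed smooth form `γ` on
  `↥U` is read as its flat extension `flatExt γ : E → Λ^{k+1}`, `C^∞` and closed on `U` (the
  dictionary `Literature/Analysis/Complex/OpensFlat`); the Banach-space Poincaré lemma
  `Literature.Analysis.Calculus.exists_extDeriv_eq_of_starConvex_of_contDiffOn`
  (`ConePoincareHomotopyBanach.lean`: Lang's cone operator, smooth by differentiation under the
  integral sign on an arbitrary normed space) gives a primitive `η`, `C^∞` on `U`, and
  `restrictOpens U η` is a smooth form on `↥U` with `d (restrictOpens U η) = γ`;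
* **`ExactSmoothFormsEqClosedSmoothFormsOfConvex_holds`** — the discharge.

The statement lives in `FormsAlgebra.lean`, upstream of the dictionary `OpensFlat` (through
`ManifoldFormsPullback`), hence this separate proof file (same pattern as `ManifoldFormsPullback.lean`
for `PullbackFacts` and `FormsAlgebraWedgeProofs.lean` for `WedgeFacts`).

[cite: Lang1995, Ch. V §4 Thm. 4.1 (p. 135–136)] [cite: Warner1983, 4.18]
[cite: BottTu1982Forms, §I.4 Cor. 4.1.1]

## References

* S. Lang, *Differential and Riemannian Manifolds*, GTM 160 (1995), Ch. V §4, Thm. 4.1. [Lang1995]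
* F. W. Warner, *Foundations of Differentiable Manifolds and Lie Groups* (1983), 4.18. [Warner1983]
* R. Bott, L. W. Tu, *Differential Forms in Algebraic Topology* (1982), §I.4, Cor. 4.1.1.
  [BottTu1982Forms]
-/

noncomputable section

open scoped Manifold ContDiff Topology
open Set Literature.Geometry.Kaehler Literature.Analysis.Complex Literature.Analysis.Calculus

namespace Literature.NumberTheory.Transcendental

variable {E : Type*} [NormedAddCommGroup E] [NormedSpace ℝ E]
  {F : Type*} [NormedAddCommGroup F] [NormedSpace ℝ F]

/-- **Exact forms are closed on an open submanifold of the model space** (`d ∘ d = 0`, Warner (1983),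
4.11, through the tree's `exactSmoothForms_le_closedSmoothForms` and the discharged chart-independence
fact `inChart_mextDeriv_holds`). [cite: Warner1983, 4.11] -/
theorem exactSmoothForms_le_closedSmoothForms_opens (U : TopologicalSpace.Opens E) (k : ℕ) :
    exactSmoothForms 𝓘(ℝ, E) U F k ≤ closedSmoothForms 𝓘(ℝ, E) U F k :=
  exactSmoothForms_le_closedSmoothForms (inChart_mextDeriv_holds 𝓘(ℝ, E) U F)

/-- **Closed forms of positive degree on a convex open subset of a Banach space are exact** (Lang
(1995), Ch. V §4, Thm. 4.1; Warner (1983), 4.18): for `U ⊆ E` convex open and `γ` a closed smooth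
`(k+1)`-form on the open submanifold `↥U` with values in a complete space `F`, `γ ∈ B^{k+1}(U)`.
Proof: `flatExt γ` is `C^∞` and closed on `U` (`isSmoothForm_iff_contDiffOn_flatExt`,
`flatExt_mextDeriv_of_mem`); the Banach-space Poincaré lemma
`exists_extDeriv_eq_of_starConvex_of_contDiffOn` (cone operator about a point of `U`) gives `η`,
`C^∞` on `U` with `dη = flatExt γ` on `U`; then `γ = d (restrictOpens U η)`
(`mextDeriv_restrictOpens`, `restrictOpens_flatExt`). [cite: Lang1995, Ch. V §4 Thm. 4.1 (p. 135–136)] -/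
theorem mem_exactSmoothForms_of_mem_closedSmoothForms_of_convex [CompleteSpace F]
    (U : TopologicalSpace.Opens E) (hU : Convex ℝ (U : Set E)) {k : ℕ}
    {γ : MForm 𝓘(ℝ, E) U F (k + 1)} (hγ : γ ∈ closedSmoothForms 𝓘(ℝ, E) U F (k + 1)) :
    γ ∈ exactSmoothForms 𝓘(ℝ, E) U F (k + 1) := by
  rcases (U : Set E).eq_empty_or_nonempty with hUe | ⟨x₀, hx₀⟩
  · -- the empty open set carries only the zero form
    have hγ0 : γ = 0 := by
      funext x
      have hx : (x : E) ∈ (U : Set E) := x.2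
      rw [hUe] at hx
      exact absurd hx (Set.notMem_empty _)
    rw [hγ0]
    exact zero_mem _
  · -- the flat extension of `γ` is `C^∞` and closed on `U`
    have hγs : ContDiffOn ℝ ∞ (flatExt γ) U := (isSmoothForm_iff_contDiffOn_flatExt γ).1 hγ.1
    have hγd : ∀ y ∈ (U : Set E), extDeriv (flatExt γ) y = 0 := by
      intro y hy
      rw [← flatExt_mextDeriv_of_mem γ hy, show mextDeriv γ = 0 from hγ.2,
        ← show (((⟨y, hy⟩ : U) : U) : E) = y from rfl, flatExt_coe]
      rfl
    -- the Banach-space Poincaré lemma about the point `x₀ ∈ U`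
    obtain ⟨η, hηs, hηd⟩ :=
      exists_extDeriv_eq_of_starConvex_of_contDiffOn U.isOpen (hU.starConvex hx₀) hγs hγd
    -- back to the open submanifold
    have hδs : IsSmoothForm (restrictOpens U η) := isSmoothForm_restrictOpens hηs
    have hδd : mextDeriv (restrictOpens U η) = γ := by
      rw [mextDeriv_restrictOpens]
      funext x
      apply ContinuousAlternatingMap.ext
      intro v
      have h1 : (restrictOpens U (extDeriv η) x : E [⋀^Fin (k + 1)]→L[ℝ] F) = extDeriv η x :=
        restrictOpens_apply _ x
      have h2 : extDeriv η x = flatExt γ x := hηd x x.2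
      have h3 : flatExt γ x = (γ x : E [⋀^Fin (k + 1)]→L[ℝ] F) := flatExt_coe γ x
      exact congrArg (fun f : E [⋀^Fin (k + 1)]→L[ℝ] F => f v) (h1.trans (h2.trans h3))
    exact Submodule.subset_span ⟨restrictOpens U η, hδs, hδd⟩

section Discharge

variable (E F) [CompleteSpace E] [CompleteSpace F]

/-- **Discharge of the named fact `ExactSmoothFormsEqClosedSmoothFormsOfConvex`** (Poincaré lemma on
convex open subsets of a complete normed space `E`, all positive degrees, coefficients in a complete
`F`: Lang (1995), Ch. V §4, Thm. 4.1; Warner (1983), 4.18; Bott–Tu (1982), Cor. 4.1.1):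
`B^{k+1}(U) = Z^{k+1}(U)`. [cite: Lang1995, Ch. V §4 Thm. 4.1 (p. 135–136)] -/
theorem ExactSmoothFormsEqClosedSmoothFormsOfConvex_holds :
    ExactSmoothFormsEqClosedSmoothFormsOfConvex E F := by
  intro U hU k
  exact le_antisymm (exactSmoothForms_le_closedSmoothForms_opens U (k + 1))
    fun γ hγ => mem_exactSmoothForms_of_mem_closedSmoothForms_of_convex U hU hγ

end Discharge

end Literature.NumberTheory.Transcendental

end
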